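import Summits.Ventures.Crystal3D.Theorems.StickyWulffConstantGenericWallFloorRunTops
import HarnessLib

/-!
# Run tops, LOCATED: the pushed-forward end carries its whole occupied segment, hence lies before any blocked site

HONEST FRAMING. Part of the venture `Summits/Ventures/Crystal3D` (cell `crystal3d-full`), helper
`--supports` the crux `CoaxialWallLaw` (stmt-Ventures-19481, `route-Ventures-StickyWulffConstant`), lane F;
written for the terrace/riser census of lane T (stmt-Ventures-23912, memo BETA-ASSEMBLY-g18, Q2) as the
geometry-free, perimeter-free, threshold-free «located currency converter» of lane F's row mechanism.
Pure finite combinatorics in a real normed space; rung credit only; F-C1 not moved.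

`…GenericWallFloorRunTops.card_runTops_le` pushes each `w`-run top `p` of a run-convex launch set `P ⊆ X` forward
to the top `q = p + m·w` of the `X`-run containing it, injectively, but its image predicate only remembers that `q`
lies on the forward ray of `p`.  Here the image predicate also remembers that THE WHOLE SEGMENT `p, p + w, …, q` IS
OCCUPIED (`card_runTops_le_located`).  Consequently, for ANY assignment of a vacant site `p + N(p)·w ∉ X` to each
top `p` (a «blocked» site: e.g. a site within distance `< 1` of a ball of another registry, `sealing_above/below`),
the end produced from `p` lies on the segment `[p, p + N(p)·w)` (`card_runTops_le_blocked`): located to the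
blocking length, with no launch-set geometry, no rim term and no threshold.  Single-ray forms:
`exists_runEnd_before` (an occupied site with a vacant site `n` steps ahead has a run end strictly before it).
-/

noncomputable section

namespace Summit.Ventures.Crystal3D.Theorems

open Finset

variable {E : Type*} [NormedAddCommGroup E] [NormedSpace ℝ E]

/-- **A run end strictly before a vacant site.**  If `p ∈ X` and `p + n·w ∉ X` then the `X`-run through `p`
along `w` tops at some `p + m·w` with `m < n`, the whole segment `p, …, p + m·w` occupied and `p + (m+1)·w`
vacant. -/
theorem exists_runEnd_before (X : Finset E) (p w : E) (hw : w ≠ 0) (hp : p ∈ X) (n : ℕ)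
    (hn : p + ((n : ℕ) : ℝ) • w ∉ X) :
    ∃ m : ℕ, m < n ∧ p + ((m : ℕ) : ℝ) • w ∈ X ∧ p + ((m + 1 : ℕ) : ℝ) • w ∉ X ∧
      ∀ k : ℕ, k ≤ m → p + ((k : ℕ) : ℝ) • w ∈ X := by
  obtain ⟨m, hm, hm1, hall⟩ := exists_runTop X p w hw hp
  refine ⟨m, ?_, hm, hm1, hall⟩
  by_contra h
  push Not at h
  exact hn (hall n h)

open scoped Classical in
/-- **Run tops inject, located form.**  `P ⊆ X` finite, `w ≠ 0`, `P` run-convex along `w`.  Then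
`#{p ∈ P : p + w ∉ P} ≤ #{q ∈ X : q + w ∉ X, q = p + m·w for a top p of P with p, p + w, …, p + m·w ∈ X}`. -/
theorem card_runTops_le_located (X P : Finset E) (w : E) (hw : w ≠ 0) (hPX : P ⊆ X)
    (hconv : ∀ p ∈ P, ∀ d : ℕ, p + ((d : ℕ) : ℝ) • w ∈ P → ∀ k : ℕ, k ≤ d → p + ((k : ℕ) : ℝ) • w ∈ P) :
    (P.filter fun p => p + w ∉ P).card ≤
      (X.filter fun q => q + w ∉ X ∧ ∃ p ∈ P, p + w ∉ P ∧ ∃ m : ℕ, q = p + ((m : ℕ) : ℝ) • w ∧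
        ∀ k : ℕ, k ≤ m → p + ((k : ℕ) : ℝ) • w ∈ X).card := by
  classical
  -- the run-top map
  have key : ∀ p ∈ P.filter (fun p => p + w ∉ P), ∃ m : ℕ, p + ((m : ℕ) : ℝ) • w ∈ X ∧
      p + ((m + 1 : ℕ) : ℝ) • w ∉ X ∧ ∀ k : ℕ, k ≤ m → p + ((k : ℕ) : ℝ) • w ∈ X := by
    intro p hp
    exact exists_runTop X p w hw (hPX (Finset.mem_filter.1 hp).1)
  choose! m hm using key
  refine Finset.card_le_card_of_injOn (fun p => p + ((m p : ℕ) : ℝ) • w) ?_ ?_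
  · intro p hp
    obtain ⟨hX, hnot, hall⟩ := hm p hp
    rw [Finset.mem_coe, Finset.mem_filter]
    refine ⟨hX, ?_, p, (Finset.mem_filter.1 hp).1, (Finset.mem_filter.1 hp).2, m p, rfl, hall⟩
    have : p + ((m p : ℕ) : ℝ) • w + w = p + ((m p + 1 : ℕ) : ℝ) • w := by
      push_cast; rw [add_smul, one_smul, add_assoc]
    rw [this]; exact hnot
  · intro p hp p' hp' heq
    simp only at heq
    by_contra hne
    have hpP : p ∈ P := (Finset.mem_filter.1 hp).1
    have hp'P : p' ∈ P := (Finset.mem_filter.1 hp').1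
    have hptop : p + w ∉ P := (Finset.mem_filter.1 hp).2
    have hp'top : p' + w ∉ P := (Finset.mem_filter.1 hp').2
    rcases lt_trichotomy (m p) (m p') with hlt | hEq | hgt
    · have hd : p = p' + (((m p' - m p : ℕ) : ℕ) : ℝ) • w := by
        have h1 : ((m p' : ℕ) : ℝ) = ((m p' - m p : ℕ) : ℝ) + ((m p : ℕ) : ℝ) := by
          push_cast [Nat.cast_sub hlt.le]; ring
        have h2 : p' + ((m p' : ℕ) : ℝ) • w = (p' + ((m p' - m p : ℕ) : ℝ) • w) + ((m p : ℕ) : ℝ) • w := by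
          rw [h1, add_smul, add_assoc]
        rw [h2] at heq
        exact add_right_cancel heq
      have h1le : 1 ≤ m p' - m p := by omega
      have hmem : p' + (((m p' - m p : ℕ) : ℕ) : ℝ) • w ∈ P := by rw [← hd]; exact hpP
      have := hconv p' hp'P (m p' - m p) hmem 1 h1le
      simp at this
      exact hp'top this
    · apply hne
      have : p + ((m p : ℕ) : ℝ) • w = p' + ((m p : ℕ) : ℝ) • w := by rw [heq, hEq]
      exact add_right_cancel this
    · have hd : p' = p + (((m p - m p' : ℕ) : ℕ) : ℝ) • w := by
        have h1 : ((m p : ℕ) : ℝ) = ((m p - m p' : ℕ) : ℝ) + ((m p' : ℕ) : ℝ) := by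
          push_cast [Nat.cast_sub hgt.le]; ring
        have h2 : p + ((m p : ℕ) : ℝ) • w = (p + ((m p - m p' : ℕ) : ℝ) • w) + ((m p' : ℕ) : ℝ) • w := by
          rw [h1, add_smul, add_assoc]
        rw [h2] at heq
        exact (add_right_cancel heq).symm
      have h1le : 1 ≤ m p - m p' := by omega
      have hmem : p + (((m p - m p' : ℕ) : ℕ) : ℝ) • w ∈ P := by rw [← hd]; exact hp'P
      have := hconv p hpP (m p - m p') hmem 1 h1le
      simp at this
      exact hptop this

open scoped Classical in
/-- **Run tops inject, blocked form (located ends).**  Same setting; if every `w`-run top `p` of `P` is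
assigned a VACANT site `p + N(p)·w ∉ X` ahead of it, then the ends lie on the segments `[p, p + N(p)·w)`:
`#{p ∈ P : p + w ∉ P} ≤ #{q ∈ X : q + w ∉ X, q = p + m·w, m < N p, p a top of P, p, …, p + m·w ∈ X}`.
No geometry of `P`, no rim term, no threshold: the located currency of the terrace/riser census. -/
theorem card_runTops_le_blocked (X P : Finset E) (w : E) (hw : w ≠ 0) (hPX : P ⊆ X)
    (hconv : ∀ p ∈ P, ∀ d : ℕ, p + ((d : ℕ) : ℝ) • w ∈ P → ∀ k : ℕ, k ≤ d → p + ((k : ℕ) : ℝ) • w ∈ P)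
    (N : E → ℕ) (hblock : ∀ p ∈ P, p + w ∉ P → p + ((N p : ℕ) : ℝ) • w ∉ X) :
    (P.filter fun p => p + w ∉ P).card ≤
      (X.filter fun q => q + w ∉ X ∧ ∃ p ∈ P, p + w ∉ P ∧ ∃ m : ℕ, m < N p ∧
        q = p + ((m : ℕ) : ℝ) • w ∧ ∀ k : ℕ, k ≤ m → p + ((k : ℕ) : ℝ) • w ∈ X).card := by
  classical
  refine (card_runTops_le_located X P w hw hPX hconv).trans (card_le_card ?_)
  intro q hq
  rw [mem_filter] at hq ⊢
  obtain ⟨hqX, hqw, p, hpP, hptop, m, hqm, hall⟩ := hq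
  refine ⟨hqX, hqw, p, hpP, hptop, m, ?_, hqm, hall⟩
  by_contra h
  push Not at h
  exact hblock p hpP hptop (hall (N p) h)

open scoped Classical in
/-- **Located ends in a window.**  Same setting; if along each top's ray the sites strictly before the
assigned vacant site all satisfy a predicate `W` («the window»), every produced end satisfies `W`:
`#{p ∈ P : p + w ∉ P} ≤ #{q ∈ X : q + w ∉ X ∧ W q}`. -/
theorem card_runTops_le_window (X P : Finset E) (w : E) (hw : w ≠ 0) (hPX : P ⊆ X)
    (hconv : ∀ p ∈ P, ∀ d : ℕ, p + ((d : ℕ) : ℝ) • w ∈ P → ∀ k : ℕ, k ≤ d → p + ((k : ℕ) : ℝ) • w ∈ P)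
    (N : E → ℕ) (hblock : ∀ p ∈ P, p + w ∉ P → p + ((N p : ℕ) : ℝ) • w ∉ X)
    (W : E → Prop) (hW : ∀ p ∈ P, p + w ∉ P → ∀ m : ℕ, m < N p → W (p + ((m : ℕ) : ℝ) • w)) :
    (P.filter fun p => p + w ∉ P).card ≤ (X.filter fun q => q + w ∉ X ∧ W q).card := by
  classical
  refine (card_runTops_le_blocked X P w hw hPX hconv N hblock).trans (card_le_card ?_)
  intro q hq
  rw [mem_filter] at hq ⊢
  obtain ⟨hqX, hqw, p, hpP, hptop, m, hmN, hqm, -⟩ := hq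
  exact ⟨hqX, hqw, hqm ▸ hW p hpP hptop m hmN⟩

/-! ### Appended (19481-p1 g18, for the LEVEL LEDGER of the terrace census, cf-p1 (ccxli) (I2)): arbitrary launch balls with
pairwise disjoint blocked segments — no run-convexity, one located end per launch ball -/

open scoped Classical in
/-- **Disjoint blocked segments carry distinct located ends.**  `P ⊆ X` any finite set of launch balls, each `p ∈ P` with a
VACANT site `p + N(p)·w ∉ X` ahead; if the segments `{p + m·w : m < N p}` (`p ∈ P`) are pairwise disjoint, then `X` has at
least `#P` run ends `q` (`q ∈ X`, `q + w ∉ X`), each on one of the segments with the stretch from its launch ball occupied.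
(For the level ledger: one launch ball per (riser, row); the segment = the row's sites from the launch ball to the riser's
blocked site; segments of different rows are on different lines, segments of one row at different risers are separated by
the blocked sites.) -/
theorem card_le_card_runEnds_of_disjoint_segments (X P : Finset E) (w : E) (hw : w ≠ 0) (hPX : P ⊆ X) (N : E → ℕ)
    (hblock : ∀ p ∈ P, p + ((N p : ℕ) : ℝ) • w ∉ X)
    (hdisj : ∀ p ∈ P, ∀ p' ∈ P, p ≠ p' → ∀ m : ℕ, m < N p → ∀ m' : ℕ, m' < N p' →
      p + ((m : ℕ) : ℝ) • w ≠ p' + ((m' : ℕ) : ℝ) • w) :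
    P.card ≤ (X.filter fun q => q + w ∉ X ∧ ∃ p ∈ P, ∃ m : ℕ, m < N p ∧
      q = p + ((m : ℕ) : ℝ) • w ∧ ∀ k : ℕ, k ≤ m → p + ((k : ℕ) : ℝ) • w ∈ X).card := by
  classical
  have key : ∀ p ∈ P, ∃ m : ℕ, m < N p ∧ p + ((m : ℕ) : ℝ) • w ∈ X ∧ p + ((m + 1 : ℕ) : ℝ) • w ∉ X ∧
      ∀ k : ℕ, k ≤ m → p + ((k : ℕ) : ℝ) • w ∈ X :=
    fun p hp => exists_runEnd_before X p w hw (hPX hp) (N p) (hblock p hp)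
  choose! m hm using key
  refine Finset.card_le_card_of_injOn (fun p => p + ((m p : ℕ) : ℝ) • w) ?_ ?_
  · intro p hp
    obtain ⟨hlt, hX, hnot, hall⟩ := hm p hp
    rw [Finset.mem_coe, Finset.mem_filter]
    refine ⟨hX, ?_, p, hp, m p, hlt, rfl, hall⟩
    have : p + ((m p : ℕ) : ℝ) • w + w = p + ((m p + 1 : ℕ) : ℝ) • w := by
      push_cast; rw [add_smul, one_smul, add_assoc]
    rw [this]; exact hnot
  · intro p hp p' hp' heq
    by_contra hne
    exact hdisj p hp p' hp' hne (m p) (hm p hp).1 (m p') (hm p' hp').1 heq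

open scoped Classical in
/-- **Disjoint blocked segments, window form**: if moreover every site of every segment satisfies `W`, then
`#P ≤ #{q ∈ X : q + w ∉ X ∧ W q}`. -/
theorem card_le_card_runEnds_window_of_disjoint_segments (X P : Finset E) (w : E) (hw : w ≠ 0) (hPX : P ⊆ X) (N : E → ℕ)
    (hblock : ∀ p ∈ P, p + ((N p : ℕ) : ℝ) • w ∉ X)
    (hdisj : ∀ p ∈ P, ∀ p' ∈ P, p ≠ p' → ∀ m : ℕ, m < N p → ∀ m' : ℕ, m' < N p' →
      p + ((m : ℕ) : ℝ) • w ≠ p' + ((m' : ℕ) : ℝ) • w)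
    (W : E → Prop) (hW : ∀ p ∈ P, ∀ m : ℕ, m < N p → W (p + ((m : ℕ) : ℝ) • w)) :
    P.card ≤ (X.filter fun q => q + w ∉ X ∧ W q).card := by
  classical
  refine (card_le_card_runEnds_of_disjoint_segments X P w hw hPX N hblock hdisj).trans (card_le_card ?_)
  intro q hq
  rw [mem_filter] at hq ⊢
  obtain ⟨hqX, hqw, p, hp, m, hmN, hqm, -⟩ := hq
  exact ⟨hqX, hqw, hqm ▸ hW p hp m hmN⟩

end Summit.Ventures.Crystal3D.Theorems

end
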